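import Mathlib
import Literature.Analysis.FluidPDE.LerayGaugeStrainSpectrum
import Literature.Analysis.FluidPDE.TypeIAncientMild
import Summits.NavierStokesRegularity.NavierStokesRegularity.Theses.SqueezeCycle

/-!
# Sketch — crux-ideate `stmt-NavierStokesRegularity-11609` (`SqueezeCycle.ExtremalBiaxialitySubcritical`),
round 1, ideator 2.  First lemmas of the two idea cards in `Ideas/`:

* `RootedRecords`  (card `rooted-records-recur-or-die`)
* `LogisticDebt`   (card `logistic-squeeze-debt`)

Everything here is a STATEMENT (`def … : Prop`) over existing declarations, plus a few one-line
sanity proofs.  Nothing is filed; provers will find the signatures quoted in the cards.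
-/

noncomputable section

open scoped InnerProductSpace Matrix
open MeasureTheory Set Filter Literature.Analysis.FluidPDE

namespace Summit.NavierStokesRegularity.NavierStokesRegularity.Cruxes.ExtremalBiaxialitySubcritical

abbrev E3 := EuclideanSpace ℝ (Fin 3)

/-- The Type-I model class `𝒦_C` of route SqueezeCycle, in the factored form proved equal to the
inline class by the refuter's `inK_iff` (Evidence2.lean on the item): the Oseen-gauge Type-I ancient
mild class `IsTypeIAncientMild C u` plus Albritton–Barker's two scale-invariant local energies. -/
def InK (C : ℝ) (u : ℝ → E3 → E3) : Prop :=
  IsTypeIAncientMild C u ∧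
    ∀ (x₀ : E3) (t₀ r : ℝ), t₀ ≤ 0 → 0 < r →
      (∀ t, t₀ - r ^ 2 < t → t < t₀ → r⁻¹ * ∫ x in Metric.ball x₀ r, ‖u t x‖ ^ 2 ≤ C) ∧
        r⁻¹ * ∫ t in Set.Ioo (t₀ - r ^ 2) t₀, ∫ x in Metric.ball x₀ r, ‖fderiv ℝ (u t) x‖ ^ 2 ≤ C

/-- The FUTURE time-shift by `ε`: `(shift ε u) t = u (t + ε)`.  For `ε > 0` it is the one
deformation of a class element that is NOT a class symmetry (past shifts `ε ≤ 0` are). -/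
def shift (ε : ℝ) (u : ℝ → E3 → E3) : ℝ → E3 → E3 := fun t => u (t + ε)

namespace RootedRecords

/-- **Clock-shift identity** (card 1, step 0): the Leray-gauge middle strain eigenvalue of the
future-shifted field at the corresponding point is the old one times the clock factor
`(−t₀ + ε)/(−t₀) > 1`:  `(−t₀) · Λ_{u(·+ε)}(t₀ − ε, x₀) = (−(t₀ − ε)) · Λ_u(t₀, x₀)`.
(`shift ε u (t₀ - ε) = u t₀` definitionally up to `sub_add_cancel`.) -/
def ClockShiftIdentity : Prop :=
  ∀ (u : ℝ → E3 → E3) (ε t₀ : ℝ) (x₀ : E3),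
    (-t₀) * lerayMiddleStrain (shift ε u) (t₀ - ε) x₀ = (-(t₀ - ε)) * lerayMiddleStrain u t₀ x₀

theorem clockShiftIdentity_holds : ClockShiftIdentity := by
  intro u ε t₀ x₀
  simp only [lerayMiddleStrain_def, shift, sub_add_cancel]
  ring

/-- **First lemma of card 1 (RecordForbidsFutureShift)**: a class element holding a positive
class-wide record of `Λ` at `(t₀, x₀)` admits NO future time-shift inside the class: for every
`ε > 0`, `u(· + ε) ∉ 𝒦_C`.  (Proof: evaluate maximality at `(t₀ − ε, x₀)` and use
`ClockShiftIdentity`: `(−t₀+ε)/(−t₀) · m ≤ m` contradicts `m > 0`.)  Consequence ("rooting"): the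
record-holder is singular at `t = 0` or saturates the constant `C`. -/
def RecordForbidsFutureShift : Prop :=
  ∀ (C m : ℝ) (u : ℝ → E3 → E3) (t₀ : ℝ) (x₀ : E3), t₀ < 0 → 0 < m → InK C u →
    m ≤ lerayMiddleStrain u t₀ x₀ →
    (∀ v : ℝ → E3 → E3, InK C v → ∀ t < 0, ∀ x, lerayMiddleStrain v t x ≤ m) →
    ∀ ε > 0, ¬ InK C (shift ε u)

theorem recordForbidsFutureShift_holds : RecordForbidsFutureShift := by
  intro C m u t₀ x₀ ht₀ hm _hu hrec hmax ε hε hshift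
  have ht' : t₀ - ε < 0 := by linarith
  have h1 : lerayMiddleStrain (shift ε u) (t₀ - ε) x₀ ≤ m := hmax _ hshift _ ht' x₀
  have hid := clockShiftIdentity_holds u ε t₀ x₀
  -- (-t₀) * Λ_shift = (-(t₀-ε)) * Λ_u ≥ (-(t₀ - ε)) * m, while (-t₀) * Λ_shift ≤ (-t₀) * m.
  have hpos : 0 < -t₀ := by linarith
  have h2 : (-t₀) * lerayMiddleStrain (shift ε u) (t₀ - ε) x₀ ≤ (-t₀) * m :=
    mul_le_mul_of_nonneg_left h1 hpos.le
  have h3 : (-(t₀ - ε)) * m ≤ (-(t₀ - ε)) * lerayMiddleStrain u t₀ x₀ :=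
    mul_le_mul_of_nonneg_left hrec (by linarith)
  nlinarith

/-- **Transfer target of card 1, part (NTR) — "no transient record"**: along every class element
the running spatial supremum of `Λ` never strictly exceeds BOTH its blow-down past and its
zoomed-in future: if `Λ_u` attains a class record `m > 0` at an interior point, then the record
RECURS along the scaling flow about some final-time centre `(x₁, 0)` — there are scales
`λ_n → 0` or `λ_n → ∞` and points `(t_n, x_n)` in a fixed compact parabolic window with
`Λ_u(λ_n² t_n, x₁ + λ_n x_n) → m` (scale covariance: this is `Λ` of the zoomed field at
`(t_n, x_n)`).  Calibration: for the unforced Leray-gauge restricted-Euler dynamics records are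
never interior — card 2's logistic skeleton. -/
def NoTransientRecord : Prop :=
  ∀ (C m : ℝ) (u : ℝ → E3 → E3) (t₀ : ℝ) (x₀ : E3), t₀ < 0 → 0 < m → InK C u →
    m ≤ lerayMiddleStrain u t₀ x₀ →
    (∀ v : ℝ → E3 → E3, InK C v → ∀ t < 0, ∀ x, lerayMiddleStrain v t x ≤ m) →
    ∃ (x₁ : E3) (R : ℝ) (lam : ℕ → ℝ) (t : ℕ → ℝ) (x : ℕ → E3), 0 < R ∧ (∀ n, 0 < lam n) ∧
      (Tendsto lam atTop (nhds 0) ∨ Tendsto lam atTop atTop) ∧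
      (∀ n, t n ∈ Set.Icc (-R) (-R⁻¹) ∧ ‖x n‖ ≤ R) ∧
      Tendsto (fun n => lerayMiddleStrain u (lam n ^ 2 * t n) (x₁ + lam n • x n)) atTop (nhds m)

/-- **Transfer target of card 1, part (RRL) — "recurrent record Liouville"**: no class element that
is UNIFORMLY RECURRENT under the scaling flow (Birkhoff: returns `ε`-close to itself, in `C⁰` on a
compact parabolic window, along a syndetic set of log-scales) holds a class record `≥ 1/8`. This
is the crux restricted to the recurrent core (periodic instance = backward DSS profiles). -/
def RecurrentRecordLiouville : Prop :=
  ∀ (C m : ℝ) (u : ℝ → E3 → E3) (t₀ : ℝ) (x₀ : E3), t₀ < 0 → InK C u →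
    (∀ ε > 0, ∀ R > 0, ∃ L > 0, ∀ a : ℝ, ∃ σ ∈ Set.Icc a (a + L),
        ∀ t ∈ Set.Icc (-R) (-R⁻¹), ∀ x : E3, ‖x‖ ≤ R →
          ‖Real.exp σ • u (Real.exp σ ^ 2 * t) (Real.exp σ • x) - u t x‖ ≤ ε) →
    m ≤ lerayMiddleStrain u t₀ x₀ →
    (∀ v : ℝ → E3 → E3, InK C v → ∀ t < 0, ∀ x, lerayMiddleStrain v t x ≤ m) →
    m < 1 / 8

end RootedRecords

namespace LogisticDebt

/-- Leray-gauge restricted-Euler vector field on `3×3` matrices (pressure Hessian reduced to its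
local isotropic part, viscosity dropped): `Ġ = −G − G² + (tr G²/3)·1`. -/
def gaugeRE (G : Matrix (Fin 3) (Fin 3) ℝ) : Matrix (Fin 3) (Fin 3) ℝ :=
  -G - G * G + ((G * G).trace / 3) • (1 : Matrix (Fin 3) (Fin 3) ℝ)

/-- **Logistic skeleton (card 2, step 0)**: on the axisymmetric-squeeze line
`G = diag(a, a, −2a)` (the shape of an ideal biaxial record, `Λ = a`) the gauge restricted-Euler
field is the LOGISTIC law with capacity `1`: `gaugeRE G = (a² − a) · diag(1, 1, −2)`.  Hence
unforced records relax (`a < 1`), sit (`a = 1`) or blow up (`a > 1`); they are never interior. -/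
def AxisymmetricLineIsLogistic : Prop :=
  ∀ a : ℝ, gaugeRE (Matrix.diagonal ![a, a, -2 * a]) =
    (a ^ 2 - a) • Matrix.diagonal ![(1 : ℝ), 1, -2]

theorem axisymmetricLineIsLogistic_holds : AxisymmetricLineIsLogistic := by
  intro a
  ext i j
  simp only [gaugeRE, Matrix.smul_apply, Matrix.trace, Matrix.diag, Matrix.diagonal_mul_diagonal,
    Matrix.diagonal_apply, smul_eq_mul]
  fin_cases i <;> fin_cases j <;> simp [Fin.sum_univ_three] <;> ring

/-- **Gauge-RE invariant law (card 2, step 0′)**: for trace-free `G`, with `Q = −½ tr G²`,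
`R = −det G`, the derivative of `Q` resp. `R` along `gaugeRE` is `−2Q − 3R` resp. `−3R + ⅔Q²`,
written as the polynomial identities `tr(G · gaugeRE G) = tr G² + 3 det G` (i.e. `Q̇ = −2Q − 3R`)
and `tr(adj G · gaugeRE G) = 3 det G − ⅔ (½ tr G²)²·…` — we record the first one. -/
def InvariantLawQ : Prop :=
  ∀ G : Matrix (Fin 3) (Fin 3) ℝ, G.trace = 0 →
    (G * gaugeRE G).trace = -(G * G).trace - 3 * G.det

/-- **First lemma of card 2 (discounted Cauchy–pressure identity)**, pure ODE algebra over
Mathlib: along a gauge trajectory where the velocity gradient `A`, the backward deformation `F`,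
the pressure Hessian `H` and the viscous matrix `V` satisfy `A' = −A − A·A − H + V` and
`F' = (A + ½·1)·F`, the quantity `e^{s/2} A F` has derivative `e^{s/2} (V − H) F`: restricted Euler
is absorbed EXACTLY into the deformation (the gauge Weber/impulse formula, differentiated). -/
def DiscountedCauchyPressure : Prop :=
  ∀ (A F H V : ℝ → Matrix (Fin 3) (Fin 3) ℝ) (s : ℝ),
    HasDerivAt A (-A s - A s * A s - H s + V s) s →
    HasDerivAt F ((A s + (1 / 2 : ℝ) • (1 : Matrix (Fin 3) (Fin 3) ℝ)) * F s) s →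
    HasDerivAt (fun σ => Real.exp (σ / 2) • (A σ * F σ))
      (Real.exp (s / 2) • ((V s - H s) * F s)) s

/-- **Squeeze debt (card 2, the forced logistic law)**: if a bounded scalar `a` on `(−∞, s₀]`
obeys `a' = a² − a + f`, stays in `[0, m]` and reaches `m` at `s₀`, then the discounted forcing
history pays at least `m(1 − m)`:  `∫_{−∞}^{s₀} e^{−(s₀−s)} f(s) ds ≥ m − m²`  (variation of
constants on `(e^{s} a)' = e^{s}(a² + f)` plus `a² ≤ m·a ≤ m²`).  For `m ∈ [1/8, 1)` the debt is
`≥ 7/64`. -/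
def SqueezeDebt : Prop :=
  ∀ (a f : ℝ → ℝ) (m s₀ : ℝ), 0 ≤ m →
    (∀ s ≤ s₀, HasDerivAt a (a s ^ 2 - a s + f s) s) →
    (∀ s ≤ s₀, 0 ≤ a s ∧ a s ≤ m) → a s₀ = m → ContinuousOn f (Set.Iic s₀) →
    (∃ B, ∀ s ≤ s₀, |f s| ≤ B) →
    m - m ^ 2 ≤ ∫ s in Set.Iic s₀, Real.exp (-(s₀ - s)) * f s

end LogisticDebt

/-- **Card 1's transfer, recorded as a statement** (not claimed provable here — the card's
`Transfer:` explains the missing descent step): NTR ∧ RRL ⇒ the crux. -/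
def RootedRecordTransfer : Prop :=
  RootedRecords.NoTransientRecord → RootedRecords.RecurrentRecordLiouville →
    Summit.NavierStokesRegularity.NavierStokesRegularity.Theses.SqueezeCycle.ExtremalBiaxialitySubcritical

end Summit.NavierStokesRegularity.NavierStokesRegularity.Cruxes.ExtremalBiaxialitySubcritical
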